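import Mathlib
import Summits.Ventures.PercRepro2.RBDefs
import Summits.Ventures.PercRepro2.RBRoot
import Summits.Ventures.PercRepro2.RBRootDefs
import Summits.Ventures.PercRepro2.RBRootEdge
import Summits.Ventures.PercRepro2.RBRootEdgePin
import Summits.Ventures.PercRepro2.RBRootEdgeMain
import Summits.Ventures.PercRepro2.RBRootEdgeT
import Summits.Ventures.PercRepro2.RBRootIsolated
import Summits.Ventures.PercRepro2.RBTwoMarkers
import Summits.Ventures.PercRepro2.RBTwoMarkersCross
import Summits.Ventures.PercRepro2.BHKMixed
import Summits.Ventures.PercRepro2.RBMarkerEdge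
import Summits.Ventures.PercRepro2.RBMarkerEdgeMain
import Summits.Ventures.PercRepro2.RBLeaf
import Summits.Ventures.PercRepro2.RBPendantW
import Summits.Ventures.PercRepro2.RBTwoMarkersMain
import Summits.Ventures.PercRepro2.RBTwoMarkersCrossMain
import Summits.Ventures.PercRepro2.RBKernel
import Summits.Ventures.PercRepro2.RBParallel
import Summits.Ventures.PercRepro2.RBKernelDefs
import Summits.Ventures.PercRepro2.RBPruneDefs
import Summits.Ventures.PercRepro2.RBKernelLeaf
import Summits.Ventures.PercRepro2.RBSeries
import Summits.Ventures.PercRepro2.RBSeriesMain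
import Summits.Ventures.PercRepro2.RBSeriesMass
import Summits.Ventures.PercRepro2.RBSeriesKernel
import Summits.Ventures.PercRepro2.RBReduceDefs
import Summits.Ventures.PercRepro2.RBReduce
import Summits.Ventures.PercRepro2.RBReducibleWDefs
import Summits.Ventures.PercRepro2.RBMarkerDefs
import Summits.Ventures.PercRepro2.RBUnmarkedPendant

/-!
# The typed row 2′RB on the class generated by the six reductions (mine-a g6; MINE-A.md §38–§39)

`RB.RBcross_and_RBsame_of_reducibleW`: both forms of the row hold at every pair `(w, p)` of the
inductive class `RB.ReducibleW` — the kernel class (`RB.RBcross_and_RBsame_of_nbhd'`), closed under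
pruning / merging / series (g5, `RBcross_and_RBsame_prune_iff`, `_merge_iff`,
`RBSeries.RBcross_and_RBsame_series_iff`), under zeroing the edges from the third vertex to
`{s, t, b, o}` (`RB.RBcross_and_RBsame_of_unmarked`, §39) and under moving from a pendant third
vertex to its neighbour (`RB.RBcross_and_RBsame_of_pendant_w`, §38).
-/

namespace Summit.Ventures.PercRepro2

namespace RB

open scoped Classical

variable {V : Type*} {E : Type*} [Fintype E] [DecidableEq E] [Fintype V] [DecidableEq V]
  {R : Type*} [Field R] [LinearOrder R] [IsStrictOrderedRing R]

/-- **The typed row on every pair `(w, p)` generated by the six reductions.** -/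
theorem RBcross_and_RBsame_of_reducibleW (ends : E → Sym2 V) (o b s t w : V) {p : E → R}
    (hr : ReducibleW ends s t b o w p) (hp : IsProbVec p) :
    RBcross p ends o b s t w ∧ RBsame p ends o b s t w := by
  induction hr with
  | kernel w p H => exact RBcross_and_RBsame_of_nbhd' hp ends o b s t w H
  | prune w p f u v hends hvu hus hut hub huo huw huniq _ ih =>
    exact (RBcross_and_RBsame_prune_iff ends o b s t w hends hvu hus hut hub huo huw huniq).2
      (ih (hp.update f le_rfl zero_le_one))
  | merge w p e e' hne hpar _ ih =>
    exact (RBcross_and_RBsame_merge_iff ends o b s t w hne hpar).2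
      (ih (RBParallel.isProbVec_merge hp e e'))
  | series w p e₀ f₁ f₂ u v₁ v₂ hends₀ hends₁ hends₂ hv₁ hv₂ h12 h01 h02 huniq hus hut hub huo huw _ ih =>
    refine (RBSeries.RBcross_and_RBsame_series_iff hp ends o b s t w u hends₀ hends₁ hends₂ hv₁ hv₂
      h12 h01 h02 huniq hus hut hub huo huw).2 (ih ?_)
    refine ((hp.update e₀ ?_ ?_).update f₁ le_rfl zero_le_one).update f₂ le_rfl zero_le_one
    · nlinarith [hp.nonneg e₀, hp.le_one e₀, mul_nonneg (hp.nonneg f₁) (hp.nonneg f₂)]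
    · nlinarith [hp.nonneg e₀, hp.le_one e₀, mul_nonneg (hp.nonneg f₁) (hp.nonneg f₂),
        mul_le_one₀ (hp.le_one f₁) (hp.nonneg f₂) (hp.le_one f₂)]
  | zeroMarked w p _ ih =>
    exact RBcross_and_RBsame_of_unmarked hp ends o b s t w (ih (isProbVec_zeroMarked hp ends o b s t w))
  | pendantW w u p f hends huw hws hwt hwb hwo huniq _ ih =>
    exact RBcross_and_RBsame_of_pendant_w hp ends o b s t w u hends huw hws hwt hwb hwo huniq (ih hp)

end RB

end Summit.Ventures.PercRepro2
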